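import Mathlib
import Summits.Ventures.PercRepro.PuncturedLYMUnif67Table
import Summits.Ventures.PercRepro.PuncturedLYMUnif67Rows1
import Summits.Ventures.PercRepro.PuncturedLYMUnif67Rows2
import Summits.Ventures.PercRepro.PuncturedLYMUnif67Rows3
import Summits.Ventures.PercRepro.PuncturedLYMUnif67Rows4
import Summits.Ventures.PercRepro.PuncturedLYMUnif67Rows5

/-!
# PercRepro — (SP) FOR ANY NUMBER OF PAIRWISE DISJOINT `6`-SETS AT LEVEL `7`: THE ROW IDENTITIES, ASSEMBLED
(p10, gen 41)

`row_check`: the row identity of every class with `Σ v c_v ≤ 7`, by nested `interval_cases` over the class counts (only the feasible classes are enumerated).  Nothing here asserts (SP).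
-/

namespace PercRepro.PuncturedLYM.Split.TypeLift.Unif67

/-- The row identity of every class, in one statement. -/
theorem row_check (n k : ℚ) (hQ : Qp n k ≠ 0) (hP : Pp n k ≠ 0) (hPc : Pc n k ≠ 0) (c1 c2 c3 c4 c5 : ℕ)
    (h : c1 + 2 * c2 + 3 * c3 + 4 * c4 + 5 * c5 ≤ 7) :
    6 * (k - ((c1 : ℚ) + c2 + c3 + c4 + c5)) * raw n k c1 c2 c3 c4 c5 0 + 5 * (c1 : ℚ) * raw n k c1 c2 c3 c4 c5 1 + 4 * (c2 : ℚ) * raw n k c1 c2 c3 c4 c5 2 + 3 * (c3 : ℚ) * raw n k c1 c2 c3 c4 c5 3 + 2 * (c4 : ℚ) * raw n k c1 c2 c3 c4 c5 4 + (c5 : ℚ) / 6 +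
      (n - 6 * k - ((7 : ℚ) - c1 - 2 * c2 - 3 * c3 - 4 * c4 - 5 * c5)) * raw n k c1 c2 c3 c4 c5 6 = Yc n / Pc n k := by
  have hb5 : c5 ≤ 1 := by omega
  interval_cases c5
  · have hb4 : c4 ≤ 1 := by omega
    interval_cases c4
    · have hb3 : c3 ≤ 2 := by omega
      interval_cases c3
      · have hb2 : c2 ≤ 3 := by omega
        interval_cases c2
        · have hb1 : c1 ≤ 7 := by omega
          interval_cases c1
          · push_cast
            linear_combination row_00000 n k hQ hP hPc
          · push_cast
            linear_combination row_10000 n k hQ hP hPc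
          · push_cast
            linear_combination row_20000 n k hQ hP hPc
          · push_cast
            linear_combination row_30000 n k hQ hP hPc
          · push_cast
            linear_combination row_40000 n k hQ hP hPc
          · push_cast
            linear_combination row_50000 n k hQ hP hPc
          · push_cast
            linear_combination row_60000 n k hQ hP hPc
          · push_cast
            linear_combination row_70000 n k hQ hP hPc
        · have hb1 : c1 ≤ 5 := by omega
          interval_cases c1
          · push_cast
            linear_combination row_01000 n k hQ hP hPc
          · push_cast
            linear_combination row_11000 n k hQ hP hPc
          · push_cast
            linear_combination row_21000 n k hQ hP hPc
          · push_cast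
            linear_combination row_31000 n k hQ hP hPc
          · push_cast
            linear_combination row_41000 n k hQ hP hPc
          · push_cast
            linear_combination row_51000 n k hQ hP hPc
        · have hb1 : c1 ≤ 3 := by omega
          interval_cases c1
          · push_cast
            linear_combination row_02000 n k hQ hP hPc
          · push_cast
            linear_combination row_12000 n k hQ hP hPc
          · push_cast
            linear_combination row_22000 n k hQ hP hPc
          · push_cast
            linear_combination row_32000 n k hQ hP hPc
        · have hb1 : c1 ≤ 1 := by omega
          interval_cases c1
          · push_cast
            linear_combination row_03000 n k hQ hP hPc
          · push_cast
            linear_combination row_13000 n k hQ hP hPc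
      · have hb2 : c2 ≤ 2 := by omega
        interval_cases c2
        · have hb1 : c1 ≤ 4 := by omega
          interval_cases c1
          · push_cast
            linear_combination row_00100 n k hQ hP hPc
          · push_cast
            linear_combination row_10100 n k hQ hP hPc
          · push_cast
            linear_combination row_20100 n k hQ hP hPc
          · push_cast
            linear_combination row_30100 n k hQ hP hPc
          · push_cast
            linear_combination row_40100 n k hQ hP hPc
        · have hb1 : c1 ≤ 2 := by omega
          interval_cases c1
          · push_cast
            linear_combination row_01100 n k hQ hP hPc
          · push_cast
            linear_combination row_11100 n k hQ hP hPc
          · push_cast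
            linear_combination row_21100 n k hQ hP hPc
        · have hb1 : c1 ≤ 0 := by omega
          interval_cases c1
          · push_cast
            linear_combination row_02100 n k hQ hP hPc
      · have hb2 : c2 ≤ 0 := by omega
        interval_cases c2
        · have hb1 : c1 ≤ 1 := by omega
          interval_cases c1
          · push_cast
            linear_combination row_00200 n k hQ hP hPc
          · push_cast
            linear_combination row_10200 n k hQ hP hPc
    · have hb3 : c3 ≤ 1 := by omega
      interval_cases c3
      · have hb2 : c2 ≤ 1 := by omega
        interval_cases c2
        · have hb1 : c1 ≤ 3 := by omega
          interval_cases c1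
          · push_cast
            linear_combination row_00010 n k hQ hP hPc
          · push_cast
            linear_combination row_10010 n k hQ hP hPc
          · push_cast
            linear_combination row_20010 n k hQ hP hPc
          · push_cast
            linear_combination row_30010 n k hQ hP hPc
        · have hb1 : c1 ≤ 1 := by omega
          interval_cases c1
          · push_cast
            linear_combination row_01010 n k hQ hP hPc
          · push_cast
            linear_combination row_11010 n k hQ hP hPc
      · have hb2 : c2 ≤ 0 := by omega
        interval_cases c2
        · have hb1 : c1 ≤ 0 := by omega
          interval_cases c1
          · push_cast
            linear_combination row_00110 n k hQ hP hPc
  · have hb4 : c4 ≤ 0 := by omega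
    interval_cases c4
    · have hb3 : c3 ≤ 0 := by omega
      interval_cases c3
      · have hb2 : c2 ≤ 1 := by omega
        interval_cases c2
        · have hb1 : c1 ≤ 2 := by omega
          interval_cases c1
          · push_cast
            linear_combination row_00001 n k hQ hP hPc
          · push_cast
            linear_combination row_10001 n k hQ hP hPc
          · push_cast
            linear_combination row_20001 n k hQ hP hPc
        · have hb1 : c1 ≤ 0 := by omega
          interval_cases c1
          · push_cast
            linear_combination row_01001 n k hQ hP hPc

end PercRepro.PuncturedLYM.Split.TypeLift.Unif67
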